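import Literature.Geometry.Lorentzian.BogovskiiPointwise
import Literature.Geometry.Lorentzian.BogovskiiVectorRegularity
import Literature.Geometry.Lorentzian.BogovskiiVectorOperator
import Literature.Geometry.Lorentzian.ConicBogovskiiKernel
import Literature.Geometry.Lorentzian.CoordTraceReversal
import HarnessLib

/-!
# The symmetric-divergence operator `T`: the tensor `(T F)^{ij}` and the pointwise identity (T2)

(trunk G08 = T-LORENTZ; family `gr`; namespace `Literature.Geometry.Lorentzian.MaoOhTao`.)

Mao–Oh–Tao (arXiv:2308.13031), Lemma 2.3 (T): for a vector density `F` with vanishing Killing moments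
(`∫ F_k = 0`, `∫ (y_m F_j − y_j F_m) = 0`) the symmetric 2-tensor

  `(T F)^{ij} = ½(SV^i_j + SV^j_i) + ½ Σ_m ∂_m (SK^{im}_j + SK^{jm}_i) − Σ_k ∂_k SK^{ij}_k`,

`SV^a_k = ∫ w (x − y)_a/|x − y|³ F_k`, `SK^{ab}_k = (S F_k)^{ab}` — i.e. the kernel
`+½(Vⁱδʲ_k + δⁱ_kVʲ) + ½∂_m(δʲ_kK^{im} + δⁱ_kK^{jm}) − ∂_kK^{ij}` with the **corrected sign** of the first term
(`BogovskiiVectorKernel.lean` documents the misprint `−½` in the printed formula) — solves `Σ_i ∂_i (T F)^{ij} = F^j`.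
`BogovskiiVectorOperator.lean` proves this in the weak, divergence form (`sum_sum_bogovskiiVectorOperator_weak_eq`);
here, using the classical regularity of `S` and `SV` (`BogovskiiPointwise.lean`, `BogovskiiVectorRegularity.lean`):

* `bogovskiiSV`, `bogovskiiT` — the vector operator and the tensor `T F` as functions; `bogovskiiS_symm`,
  `bogovskiiT_symm` (`T F` is symmetric);
* `pd_bogovskiiT` — the components of `∂_l (T F)^{ij}`;
* `sum_pd_bogovskiiT_eq` — **(T2) pointwise**: `Σ_i ∂_i (T F)^{ij}(x) = F^j(x)` for every `x`
  (`η ∈ C²_c`, `∫ η = 1`, `F ∈ C²_c` with vanishing Killing moments).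

## References

* Y. Mao, S.-J. Oh, T. Tao, arXiv:2308.13031 (2023), Lemma 2.3, p. 8 (key `MaoOhTao2023`).
-/

noncomputable section

open scoped RealInnerProductSpace Topology ContDiff
open Filter MeasureTheory Set Metric Function

namespace Literature.Geometry.Lorentzian

namespace MaoOhTao

variable {η : E3 → ℝ} {R : ℝ} {F : Fin 3 → E3 → ℝ}

/-- **The vector operator** `(SV_η g)^a(x) = ∫ w_y(|x − y|, (x − y)/|x − y|) (x − y)_a/|x − y|³ g(y) dy`.
[cite: MaoOhTao2023, Lemma 2.3] -/
def bogovskiiSV (η g : E3 → ℝ) (a : Fin 3) (x : E3) : ℝ :=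
  ∫ y : E3, bogovskiiWeight η y ‖x - y‖ (‖x - y‖⁻¹ • (x - y)) * ((x - y) a * (‖x - y‖ ^ 3)⁻¹) * g y

/-- Unfolding `bogovskiiSV`. [folklore] -/
theorem bogovskiiSV_apply (η g : E3 → ℝ) (a : Fin 3) (x : E3) :
    bogovskiiSV η g a x =
      ∫ y : E3, bogovskiiWeight η y ‖x - y‖ (‖x - y‖⁻¹ • (x - y)) * ((x - y) a * (‖x - y‖ ^ 3)⁻¹) * g y := rfl

/-- **The tensor `(T F)^{ij}`** (corrected sign):
`½(SV^i_j + SV^j_i) + ½ Σ_m ∂_m (SK^{im}_j + SK^{jm}_i) − Σ_k ∂_k SK^{ij}_k`. [cite: MaoOhTao2023, Lemma 2.3] -/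
def bogovskiiT (η : E3 → ℝ) (F : Fin 3 → E3 → ℝ) (i j : Fin 3) (x : E3) : ℝ :=
  (1 / 2 : ℝ) * (bogovskiiSV η (F j) i x + bogovskiiSV η (F i) j x) +
    (1 / 2 : ℝ) * (∑ m, (pd m (bogovskiiS η (F j) i m) x + pd m (bogovskiiS η (F i) j m) x)) -
    ∑ k, pd k (bogovskiiS η (F k) i j) x

/-- `S` is symmetric: `(S g)^{ab} = (S g)^{ba}`. [folklore] -/
theorem bogovskiiS_symm (η g : E3 → ℝ) (a b : Fin 3) : bogovskiiS η g a b = bogovskiiS η g b a := by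
  funext x
  simp only [bogovskiiS]
  refine integral_congr_ae (ae_of_all _ fun y ↦ ?_)
  ring

/-- **`T F` is symmetric.** [cite: MaoOhTao2023, Lemma 2.3] -/
theorem bogovskiiT_symm (η : E3 → ℝ) (F : Fin 3 → E3 → ℝ) (i j : Fin 3) (x : E3) :
    bogovskiiT η F i j x = bogovskiiT η F j i x := by
  simp only [bogovskiiT, Finset.sum_add_distrib, bogovskiiS_symm η (F _) j i]
  ring

/-- `SV_η g` is `C¹` (`η, g ∈ C¹_c`). [cite: MaoOhTao2023, Lemma 2.3] -/
theorem contDiff_one_bogovskiiSV (hη : ContDiff ℝ 1 η) (hR : ∀ z : E3, R < ‖z‖ → η z = 0) {g : E3 → ℝ}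
    (hg : ContDiff ℝ 1 g) (hgc : HasCompactSupport g) (a : Fin 3) : ContDiff ℝ 1 (bogovskiiSV η g a) :=
  contDiff_one_bogovskiiVOperator hη hR hg hgc a

/-- `∂_m SV_η g = SV_{∂_mη} g + SV_η ∂_m g` (`η, g ∈ C¹_c`). [cite: MaoOhTao2023, Lemma 2.3] -/
theorem pd_bogovskiiSV (hη : ContDiff ℝ 1 η) (hR : ∀ z : E3, R < ‖z‖ → η z = 0) {g : E3 → ℝ}
    (hg : ContDiff ℝ 1 g) (hgc : HasCompactSupport g) (a m : Fin 3) :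
    pd m (bogovskiiSV η g a) = fun x ↦ bogovskiiSV (pd m η) g a x + bogovskiiSV η (pd m g) a x :=
  funext fun x ↦ pd_bogovskiiVOperator hη hR hg hgc a m x

/-- `∂` of the zero function vanishes. [folklore] -/
theorem pd_zero_fun' (m : Fin 3) : pd m (0 : E3 → ℝ) = 0 := by
  funext x
  simp [pd, fderiv_zero]

section T2

variable (hη : ContDiff ℝ 2 η) (hR : ∀ z : E3, R < ‖z‖ → η z = 0)
  (hF : ∀ k, ContDiff ℝ 2 (F k)) (hFc : ∀ k, HasCompactSupport (F k))
include hη hR hF hFc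

/-- `SK = S F_k ∈ C²`. [folklore] -/
theorem contDiff_two_SK (k a b : Fin 3) : ContDiff ℝ 2 (bogovskiiS η (F k) a b) :=
  contDiff_two_bogovskiiS hη hR (hF k) (hFc k) a b

/-- `SV F_k ∈ C¹`. [folklore] -/
theorem contDiff_one_SV (k a : Fin 3) : ContDiff ℝ 1 (bogovskiiSV η (F k) a) :=
  contDiff_one_bogovskiiSV (hη.of_le (by norm_num)) hR ((hF k).of_le (by norm_num)) (hFc k) a

/-- `∂_m SK ∈ C¹`. [folklore] -/
theorem contDiff_one_pd_SK (k a b m : Fin 3) : ContDiff ℝ 1 (pd m (bogovskiiS η (F k) a b)) :=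
  contDiff_pd (n := 1) (contDiff_two_SK hη hR hF hFc k a b) m

/-- **`T F ∈ C¹`.** [cite: MaoOhTao2023, Lemma 2.3] -/
theorem contDiff_one_bogovskiiT (i j : Fin 3) : ContDiff ℝ 1 (bogovskiiT η F i j) := by
  unfold bogovskiiT
  refine ((contDiff_const.mul ((contDiff_one_SV hη hR hF hFc j i).add (contDiff_one_SV hη hR hF hFc i j))).add
    (contDiff_const.mul (ContDiff.sum fun m _ ↦ (contDiff_one_pd_SK hη hR hF hFc j i m m).add
      (contDiff_one_pd_SK hη hR hF hFc i j m m)))).sub (ContDiff.sum fun k _ ↦ contDiff_one_pd_SK hη hR hF hFc k i j k)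

/-- **Components of `∂_l (T F)^{ij}`.** [folklore] -/
theorem pd_bogovskiiT (i j l : Fin 3) (x : E3) :
    pd l (bogovskiiT η F i j) x =
      (1 / 2 : ℝ) * (pd l (bogovskiiSV η (F j) i) x + pd l (bogovskiiSV η (F i) j) x) +
        (1 / 2 : ℝ) * (∑ m, (pd l (pd m (bogovskiiS η (F j) i m)) x + pd l (pd m (bogovskiiS η (F i) j m)) x)) -
        ∑ k, pd l (pd k (bogovskiiS η (F k) i j)) x := by
  have dSV : ∀ k a, DifferentiableAt ℝ (bogovskiiSV η (F k) a) x := fun k a ↦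
    (contDiff_one_SV hη hR hF hFc k a).differentiable one_ne_zero x
  have dSK : ∀ k a b m, DifferentiableAt ℝ (pd m (bogovskiiS η (F k) a b)) x := fun k a b m ↦
    (contDiff_one_pd_SK hη hR hF hFc k a b m).differentiable one_ne_zero x
  have h0 := ((((dSV j i).hasFDerivAt.add (dSV i j).hasFDerivAt).const_mul (1 / 2 : ℝ)).add
    ((HasFDerivAt.sum (u := Finset.univ) fun m _ ↦
      ((dSK j i m m).hasFDerivAt.add (dSK i j m m).hasFDerivAt)).const_mul (1 / 2 : ℝ))).sub
    (HasFDerivAt.sum (u := Finset.univ) fun k _ ↦ (dSK k i j k).hasFDerivAt)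
  have h : HasFDerivAt (bogovskiiT η F i j)
      ((1 / 2 : ℝ) • (fderiv ℝ (bogovskiiSV η (F j) i) x + fderiv ℝ (bogovskiiSV η (F i) j) x) +
        (1 / 2 : ℝ) • (∑ m, (fderiv ℝ (pd m (bogovskiiS η (F j) i m)) x + fderiv ℝ (pd m (bogovskiiS η (F i) j m)) x)) -
        ∑ k, fderiv ℝ (pd k (bogovskiiS η (F k) i j)) x) x := by
    refine h0.congr_of_eventuallyEq (Eventually.of_forall fun y ↦ ?_)
    simp only [bogovskiiT, Pi.add_apply, Pi.sub_apply, Finset.sum_apply]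
  rw [show pd l (bogovskiiT η F i j) x = fderiv ℝ (bogovskiiT η F i j) x (e l) from rfl, h.fderiv]
  simp only [_root_.sub_apply, _root_.add_apply, FunLike.coe_smul, Pi.smul_apply,
    FunLike.coe_sum, Finset.sum_apply, smul_eq_mul]
  rfl


/-- **(T2) pointwise**: `Σ_i ∂_i (T F)^{ij}(x) = F^j(x)` for every `x`, for `η ∈ C²_c` with `∫ η = 1` and
`F ∈ C²_c` with vanishing Killing moments (`∫ F_k = 0`, `∫ y_m F_j = ∫ y_j F_m`).
[cite: MaoOhTao2023, Lemma 2.3 (T2)] -/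
theorem sum_pd_bogovskiiT_eq (hη1 : ∫ z : E3, η z = 1) (hF0 : ∀ k, ∫ y : E3, F k y = 0)
    (hFA : ∀ m j : Fin 3, ∫ y : E3, y m * F j y = ∫ y : E3, y j * F m y) (j : Fin 3) (x : E3) :
    ∑ i, pd i (bogovskiiT η F i j) x = F j x := by
  have hη1c : ContDiff ℝ 1 η := hη.of_le (by norm_num)
  have hS2 := contDiff_two_SK hη hR hF hFc
  have hSV1 := contDiff_one_SV hη hR hF hFc
  set G : E3 → ℝ := fun x ↦ ∑ i, pd i (bogovskiiT η F i j) x with hG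
  have hGc : Continuous G := continuous_finsetSum _ fun i _ ↦
    (contDiff_pd (n := 0) (contDiff_one_bogovskiiT hη hR hF hFc i j) i).continuous
  -- continuity of the building blocks of `∂_i (T F)^{ij}`
  have cSV : ∀ k a c, Continuous (pd c (bogovskiiSV η (F k) a)) := fun k a c ↦
    (contDiff_pd (n := 0) (hSV1 k a) c).continuous
  have cSK : ∀ k a b c d, Continuous (pd d (pd c (bogovskiiS η (F k) a b))) := fun k a b c d ↦
    (contDiff_pd (n := 0) (contDiff_pd (n := 1) (hS2 k a b) c) d).continuous
  have key : ∀ ψ : E3 → ℝ, ContDiff ℝ ∞ ψ → HasCompactSupport ψ →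
      ∫ x, ψ x • G x = ∫ x, ψ x • F j x := by
    intro ψ hψ hψc
    have hψ2 : ContDiff ℝ 2 ψ := hψ.of_le (by norm_cast)
    have hψ1 : ContDiff ℝ 1 ψ := hψ.of_le (by norm_cast)
    have hI : ∀ g : E3 → ℝ, Continuous g → Integrable fun x ↦ ψ x * g x := fun g hg ↦
      (hψ.continuous.mul hg).integrable_of_hasCompactSupport hψc.mul_right
    -- the weak identity tested against `Ψ = ψ e_j`
    set Ψ : Fin 3 → E3 → ℝ := fun j' ↦ if j' = j then ψ else 0 with hΨ
    have hΨj : Ψ j = ψ := if_pos rfl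
    have hΨne : ∀ j', j' ≠ j → Ψ j' = 0 := fun j' h ↦ if_neg h
    have hΨd : ∀ j', ContDiff ℝ 2 (Ψ j') := fun j' ↦ by
      by_cases h : j' = j
      · rw [h, hΨj]; exact hψ2
      · rw [hΨne j' h]; exact contDiff_const
    have hΨc : ∀ j', HasCompactSupport (Ψ j') := fun j' ↦ by
      by_cases h : j' = j
      · rw [h, hΨj]; exact hψc
      · rw [hΨne j' h]; exact HasCompactSupport.zero
    have hweak := sum_sum_bogovskiiVectorOperator_weak_eq hη1c hR (fun k ↦ (hF k).continuous) hFc hF0 hFA hΨd hΨc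
    -- collapse the `j'`-sums to `j' = j`
    have hRHS : ∑ j', ∫ y : E3, F j' y * Ψ j' y = ∫ y : E3, F j y * ψ y := by
      rw [Finset.sum_eq_single_of_mem j (Finset.mem_univ j) (fun j' _ hj' ↦ by simp [hΨne j' hj']), hΨj]
    rw [hη1, one_mul, hRHS, Finset.sum_eq_single_of_mem j (Finset.mem_univ j) (fun j' _ hj' ↦ by
      simp [hΨne j' hj', pd_zero_fun']), hΨj] at hweak
    simp only [← bogovskiiSV_apply, ← bogovskiiS_apply] at hweak
    -- integrations by parts
    have IBP1 : ∀ a c k, ∫ x, bogovskiiSV η (F k) a x * pd c ψ x = -∫ x, ψ x * pd c (bogovskiiSV η (F k) a) x := by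
      intro a c k
      calc ∫ x, bogovskiiSV η (F k) a x * pd c ψ x = ∫ x, pd c ψ x * bogovskiiSV η (F k) a x :=
            integral_congr_ae (ae_of_all _ fun x ↦ mul_comm _ _)
        _ = -∫ x, ψ x * pd c (bogovskiiSV η (F k) a) x := integral_pd_mul_eq_neg hψ1 hψc (hSV1 k a) c
    have IBP2 : ∀ a b c d k, ∫ x, bogovskiiS η (F k) a b x * pd c (pd d ψ) x =
        ∫ x, ψ x * pd d (pd c (bogovskiiS η (F k) a b)) x := fun a b c d k ↦
      integral_mul_pd_pd_eq (hS2 k a b) hψ2 hψc d c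
    simp only [IBP1, IBP2] at hweak
    -- collapse the Kronecker delta and split the `k`-sum
    simp only [ite_mul, one_mul, zero_mul] at hweak
    rw [Finset.sum_add_distrib, Finset.sum_sub_distrib, Finset.sum_add_distrib, Finset.sum_ite_eq,
      if_pos (Finset.mem_univ j)] at hweak
    -- commute the mixed partials in the last family: `∂_k∂_i SK^{ij}_k = ∂_i∂_k SK^{ij}_k`
    have Ecomm : ∀ i k, ∫ x, ψ x * pd k (pd i (bogovskiiS η (F k) i j)) x =
        ∫ x, ψ x * pd i (pd k (bogovskiiS η (F k) i j)) x := fun i k ↦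
      integral_congr_ae (ae_of_all _ fun x ↦ by
        show ψ x * pd k (pd i (bogovskiiS η (F k) i j)) x = ψ x * pd i (pd k (bogovskiiS η (F k) i j)) x
        rw [pd_pd_comm ((hS2 k i j).contDiffAt) k i])
    rw [Finset.sum_congr rfl fun k _ ↦ Finset.sum_congr rfl fun i _ ↦ Ecomm i k] at hweak
    -- the left-hand side `∫ ψ G`
    have hTi : ∀ i, ∫ x, ψ x * pd i (bogovskiiT η F i j) x =
        (1 / 2 : ℝ) * ((∫ x, ψ x * pd i (bogovskiiSV η (F j) i) x) + ∫ x, ψ x * pd i (bogovskiiSV η (F i) j) x) +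
        (1 / 2 : ℝ) * (∑ m, ((∫ x, ψ x * pd i (pd m (bogovskiiS η (F j) i m)) x) +
          ∫ x, ψ x * pd i (pd m (bogovskiiS η (F i) j m)) x)) -
        ∑ k, ∫ x, ψ x * pd i (pd k (bogovskiiS η (F k) i j)) x := by
      intro i
      have h1 := hI _ (cSV j i i)
      have h2 := hI _ (cSV i j i)
      have h3 := fun m ↦ hI _ (cSK j i m m i)
      have h4 := fun m ↦ hI _ (cSK i j m m i)
      have h5 := fun k ↦ hI _ (cSK k i j k i)
      have h12 : Integrable fun x ↦ ψ x * pd i (bogovskiiSV η (F j) i) x + ψ x * pd i (bogovskiiSV η (F i) j) x :=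
        h1.add h2
      have h34 : ∀ m, Integrable fun x ↦ ψ x * pd i (pd m (bogovskiiS η (F j) i m)) x +
          ψ x * pd i (pd m (bogovskiiS η (F i) j m)) x := fun m ↦ (h3 m).add (h4 m)
      have hS34 : Integrable fun x ↦ ∑ m, (ψ x * pd i (pd m (bogovskiiS η (F j) i m)) x +
          ψ x * pd i (pd m (bogovskiiS η (F i) j m)) x) := integrable_finsetSum _ fun m _ ↦ h34 m
      have hS5 : Integrable fun x ↦ ∑ k, ψ x * pd i (pd k (bogovskiiS η (F k) i j)) x :=
        integrable_finsetSum _ fun k _ ↦ h5 k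
      have hA : Integrable fun x ↦ (1 / 2 : ℝ) * (ψ x * pd i (bogovskiiSV η (F j) i) x +
          ψ x * pd i (bogovskiiSV η (F i) j) x) := h12.const_mul _
      have hB : Integrable fun x ↦ (1 / 2 : ℝ) * (∑ m, (ψ x * pd i (pd m (bogovskiiS η (F j) i m)) x +
            ψ x * pd i (pd m (bogovskiiS η (F i) j m)) x)) := hS34.const_mul _
      have hAB : Integrable fun x ↦ (1 / 2 : ℝ) * (ψ x * pd i (bogovskiiSV η (F j) i) x +
          ψ x * pd i (bogovskiiSV η (F i) j) x) + (1 / 2 : ℝ) * (∑ m, (ψ x * pd i (pd m (bogovskiiS η (F j) i m)) x +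
            ψ x * pd i (pd m (bogovskiiS η (F i) j m)) x)) := hA.add hB
      have hrw : ∀ x, ψ x * pd i (bogovskiiT η F i j) x =
          (1 / 2 : ℝ) * (ψ x * pd i (bogovskiiSV η (F j) i) x + ψ x * pd i (bogovskiiSV η (F i) j) x) +
          (1 / 2 : ℝ) * (∑ m, (ψ x * pd i (pd m (bogovskiiS η (F j) i m)) x +
            ψ x * pd i (pd m (bogovskiiS η (F i) j m)) x)) -
          ∑ k, ψ x * pd i (pd k (bogovskiiS η (F k) i j)) x := by
        intro x
        rw [pd_bogovskiiT hη hR hF hFc i j i x]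
        simp only [Finset.sum_add_distrib, ← Finset.mul_sum]
        ring
      calc ∫ x, ψ x * pd i (bogovskiiT η F i j) x
          = ∫ x, ((1 / 2 : ℝ) * (ψ x * pd i (bogovskiiSV η (F j) i) x + ψ x * pd i (bogovskiiSV η (F i) j) x) +
              (1 / 2 : ℝ) * (∑ m, (ψ x * pd i (pd m (bogovskiiS η (F j) i m)) x +
                ψ x * pd i (pd m (bogovskiiS η (F i) j m)) x))) -
              ∑ k, ψ x * pd i (pd k (bogovskiiS η (F k) i j)) x := integral_congr_ae (ae_of_all _ hrw)
        _ = ((1 / 2 : ℝ) * ((∫ x, ψ x * pd i (bogovskiiSV η (F j) i) x) + ∫ x, ψ x * pd i (bogovskiiSV η (F i) j) x) +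
              (1 / 2 : ℝ) * ∫ x, ∑ m, (ψ x * pd i (pd m (bogovskiiS η (F j) i m)) x +
                ψ x * pd i (pd m (bogovskiiS η (F i) j m)) x)) -
              ∑ k, ∫ x, ψ x * pd i (pd k (bogovskiiS η (F k) i j)) x := by
            rw [integral_sub hAB hS5, integral_add hA hB, integral_const_mul, integral_const_mul, integral_add h1 h2,
              integral_finsetSum _ (fun k _ ↦ h5 k)]
        _ = _ := by
            rw [integral_finsetSum _ (fun m _ ↦ h34 m)]
            simp only [integral_add (h3 _) (h4 _)]
    have hGint : ∫ x, ψ x * G x = ∑ i, ∫ x, ψ x * pd i (bogovskiiT η F i j) x := by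
      rw [← integral_finsetSum _ fun i _ ↦
        hI _ (contDiff_pd (n := 0) (contDiff_one_bogovskiiT hη hR hF hFc i j) i).continuous]
      refine integral_congr_ae (ae_of_all _ fun x ↦ ?_)
      simp only [hG, Finset.mul_sum]
    simp only [smul_eq_mul]
    rw [hGint]
    simp only [hTi]
    have hε : ∑ k, ∑ i, ∫ x, ψ x * pd i (pd k (bogovskiiS η (F k) i j)) x =
        ∑ i, ∑ k, ∫ x, ψ x * pd i (pd k (bogovskiiS η (F k) i j)) x := Finset.sum_comm
    have hFψ : ∫ y, F j y * ψ y = ∫ x, ψ x * F j x := integral_congr_ae (ae_of_all _ fun x ↦ mul_comm _ _)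
    rw [hFψ, hε] at hweak
    simp only [Finset.sum_add_distrib, Finset.sum_sub_distrib, Finset.sum_neg_distrib, mul_add, mul_neg,
      ← Finset.mul_sum] at hweak ⊢
    linarith
  have hae : ∀ᵐ x ∂(volume : Measure E3), G x = F j x :=
    ae_eq_of_integral_contDiff_smul_eq hGc.locallyIntegrable (hF j).continuous.locallyIntegrable key
  exact congrFun ((hGc.ae_eq_iff_eq volume (hF j).continuous).1 hae) x

end T2

end MaoOhTao

end Literature.Geometry.Lorentzian

end
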